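import Summits.QuantumFields.YangMills.Theorems.FluctuationComparisonRegPrIntLLargeFieldGasKnit
import Summits.QuantumFields.YangMills.Theorems.FluctuationComparisonRegPrIntLLargeFieldGasCanonicalTransfer
import HarnessLib

/-!
# (R-KNIT, a.e. edition) · A.E. HISTORY RATIOS + FACTORISED HISTORIES ⟹ THE A.E. GAS IDENTITY WITH CONTINUOUS KOTECKÝ–PREISS ACTIVITIES
# — the hypothesis shape of px10 g16's (G5) `…LargeFieldGasCanonicalTransfer.canInt_body_of_ae` (LFG^{ae}∘ body), from the 𝐑-operation's output socket

Cell `ym3-torus` (HUMAN RULING D-0037: rung R3 = continuum `SU(2)` Yang–Mills on `T³` — NOT `d = 4`, NOT infinite volume, NOT a mass gap, NOT the Clay problem);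
seat `ymfull-r3-prover-1` (gen 0; director-ym R600-ym ∕ ★★OWNER ym3-torus RULING №57 (B): hand = the registered stub `stub_largeFieldFourPtIntCan`, registry
`Cruxes/FluctuationComparisonRegPrIntL/Lines/semiclassical_s2beta.lean` v11.4, plan document `Lines/largefield_gas.lean` v3); helper of the crux `stmt-QuantumFields-20520`
`UnitScaleTilt.FluctuationComparisonRegPrIntL` (`--supports … --as helper`, NOT a proof of it); FILE 4 of this seat's LOCATE-R (20520 evidence #56; FILES 1–3 =
`…LargeFieldGasEntropyCriterion` (R3-E), `…LargeFieldGasAggregation` (R3-A), `…LargeFieldGasKnit` (generic knit)).  THEOREMS ONLY: 0 `def`, 0 `instance`, 0 `notation`,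
0 `sorry`, default heartbeats.

WHERE THIS SITS.  The tree suppliers of the 𝐑-operation speak A.E. (`heightDensity` is an honest `L¹` density: ✓`…HistoryPartition.heightDensity_eq_sum_histories_ae`, px10 g16's
✓`…LargeFieldGasWindowCut.heightDensity_univ_ae_eq_sum_deep_on_window`), while LFG^{can}∘ is POINTWISE on canonical versions; px10 g16's (G5) `…LargeFieldGasCanonicalTransfer`
(`canInt_body_of_ae` ∕ `canInt_of_aeInt`) bridges the two GIVEN «`∃ cst w`, a Kotecký–Preiss gas on the window, activities CONTINUOUS on the window, and the gas identity
`full = e^{cst}·hist·Re Ξ(w)` A.E. on the window».  This file produces exactly that triple from the hand's socket, for ANY measure `μ` on fields `B → G'`, any window `W`, any finite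
history index: (H+W) `full = Σ_{Q ∈ D} g Q` a.e. on `W`; per history `Q ∈ D` the A.E. RATIO identity `g Q = hist·r Q` on `W` (the cluster expansion with holes identifies the
ratio of the `histEvent Q` density to the all-small one as a continuous function); the FACTORISATION `r Q U = Σ_{𝒳 compatible, Q ∈ Dec 𝒳} Π ζ(Q↾X, X, U)` pointwise on `W` with
CONTINUOUS, V-local component activities; off `D` the ratios vanish on `W`; and FILE 3's energy ∕ budget ∕ geometry letters.

* §1 `ratio_eq_zero_of_not_deep` — the vanishing off `D` is automatic when `D = {Q | every label of Q is deep}` and admissible sub-histories carry deep labels only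
  (then no compatible family decomposes a non-deep `Q`).
* §2 ★★★ `aeGas_of_factorised_histories` — the a.e. knit: conclusion `∃ cst w, (∃ wbar a ℓ, KPGasOn-clauses with the caller's dist ∕ ℓ, N := σ₀) ∧ (∀ X, ContinuousOn (w · X) W) ∧
  ∀ᵐ U ∂μ, U ∈ W → full U = e^{cst}·hist U·Re Ξ_{polyInc}(w U)` (`cst = 0`) — the `h` of (G5)'s `canInt_body_of_ae` once `B := PBond (F.P J) 0`, `μ := dU_J`, `W := W_J^{c}`,
  `full ∕ hist := heightDensity … univ ∕ histGood(b₀)`, `dist := tdist`, `σ₀ := Ψ J` are substituted (all binders explicit; the substitution is an `exact`).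
* §3 ★★★ `canIntBody_of_factorised_histories` — THAT SUBSTITUTION, composed with px10 g16's ✓`…LargeFieldGasCanonicalTransfer.canInt_body_of_ae` under (r1∘): the ∃-body of
  LFG^{can}∘ at one `(J, K)` (the per-`(J,K)` text of the hypothesis of ✓`…LargeFieldGasInteriorDoor.largeFieldFourPtIntCan_of_canInt`) from the socket letters in T³ currency.

HONEST — WHAT THIS IS NOT.  A knit over FILE 3 plus one `filter_upwards`: NOTHING of the socket (the factorised small-field expansion with holes for the d = 3 tower, its a.e.
ratio identities, continuity and energy bounds = Bałaban's large-field renormalisation, XL) is proved; LFG^{ae}∘ ∕ LFG^{can}∘ ∕ `stub_largeFieldFourPtIntCan` ∕ S2β ∕ the crux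
20520 NOT proved; `YM3TorusSU2` NOT proved; finite volume ∕ conditional; the Yang–Mills mass gap (Clay) NOT proved; rung R3 = YM₃ on `T³` — NOT `d = 4`, NOT infinite volume,
NOT a mass gap.
References: [Balaban1985UV3] T. Bałaban, CMP 102 (1985): (40)–(41) p.266, (43)–(47) pp.266–267, (67)–(71) pp.273–274; [Balaban1989LargeFieldII] CMP 122 (1989): (1.90)–(1.91)
p.388, (1.97)–(1.101) pp.389–390; [Balaban1987RG1] CMP 109 (1987) (0.13) p.254; [KoteckyPreiss1986] CMP 103 (1986), Theorem p.492 (1).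
-/

set_option autoImplicit false

noncomputable section

open Finset MeasureTheory
open scoped BigOperators
open Literature.Probability.LatticeModels
open Summit.QuantumFields.YangMills.Theorems.FluctuationComparisonRegPrIntLLargeFieldGasAggregation
open Summit.QuantumFields.YangMills.Theorems.FluctuationComparisonRegPrIntLLargeFieldGasKnit

namespace Summit.QuantumFields.YangMills.Theorems.FluctuationComparisonRegPrIntLLargeFieldGasKnitAE

variable {B : Type*} [Fintype B] [DecidableEq B] {Λ : Type*} [Fintype Λ] [DecidableEq Λ] {G' : Type*}

/-! ## §1 Off the deep histories the factorised ratios vanish -/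

open Classical in
/-- **NON-DEEP HISTORIES DO NOT DECOMPOSE**: if admissible sub-histories carry deep labels only and are located inside their component, then a history with a non-deep
label belongs to `Dec 𝒳` for no family `𝒳`, so its factorised expansion is the empty sum. [cite: Balaban1985UV3, (40) p.266 («on the support of χ_k only Z_k = ∅»)] -/
theorem ratio_eq_zero_of_not_deep (π : Λ → B) (Adm : Finset Λ → Finset B → Prop) (ζ : Finset Λ → Finset B → ℝ) (deep : Λ → Prop)
    (hAdm : ∀ Q' X, Adm Q' X → ∀ l ∈ Q', π l ∈ X ∧ deep l) (Q : Finset Λ) (hQ : ¬ ∀ l ∈ Q, deep l) :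
    ∑ 𝒳 ∈ (Finset.univ : Finset (Finset B)).powerset.filter (fun 𝒳 => IsCompatible polyInc 𝒳 ∧
        (∀ l ∈ Q, ∃ X ∈ 𝒳, π l ∈ X) ∧ ∀ X ∈ 𝒳, Adm (Q.filter fun l => π l ∈ X) X),
        ∏ X ∈ 𝒳, ζ (Q.filter fun l => π l ∈ X) X = 0 := by
  refine Finset.sum_eq_zero fun 𝒳 h𝒳 => ?_
  exfalso
  obtain ⟨-, -, hloc, hadm⟩ := Finset.mem_filter.mp h𝒳
  apply hQ
  intro l hl
  obtain ⟨X, hX, hlX⟩ := hloc l hl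
  exact (hAdm _ X (hadm X hX) l (Finset.mem_filter.mpr ⟨hl, hlX⟩)).2

/-! ## §2 The a.e. knit -/

open Classical in
/-- ★★★ **A.E. HISTORY RATIOS + FACTORISED HISTORIES ⟹ `∃ cst w`, KOTECKÝ–PREISS GAS (pinned size `σ₀`) ∧ CONTINUOUS ACTIVITIES ∧ THE A.E. GAS IDENTITY** — the hypothesis of
px10 g16's `canInt_body_of_ae` (LFG^{ae}∘'s ∃-body), produced from the 𝐑-operation's output socket: (H+W) `hsum`, the a.e. ratio identities `hrat` on the deep histories `D`
with `hoff` off `D`, the pointwise factorisation `hr` with continuous V-local component activities (`hζc`, `hloc`, `hdom`), the energy `hζ`, the budget `hσ`, and FILE 3's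
geometry; `cst = 0`. [cite: Balaban1989LargeFieldII, (1.90)-(1.91) p.388 and (1.97)-(1.101) pp.389-390; Balaban1985UV3, (41) p.266 and (67)-(71) pp.273-274; Balaban1987RG1, (0.13) p.254] -/
theorem aeGas_of_factorised_histories [MeasurableSpace (B → G')] [TopologicalSpace G'] (μ : Measure (B → G'))
    -- footprint geometry (as in FILE 3)
    {C : Type*} [Fintype C] [DecidableEq C] (H : SimpleGraph C) [DecidableRel H.Adj] {Δ : ℕ} (hΔ : ∀ c, H.degree c ≤ Δ) (h1Δ : 1 ≤ Δ)
    (cell : C → Finset B) {m s₀ : ℕ} (hm : ∀ e : B, (Finset.univ.filter fun c : C => e ∈ cell c).card ≤ m) (h1m : 1 ≤ m)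
    (hs₀ : ∀ c, (cell c).card ≤ s₀) (size : Finset B → ℕ)
    (dist : B → B → ℝ) (ℓ : Finset B → ℝ) (ℓ₀ : ℝ) (hℓ0 : ∀ X, 0 ≤ ℓ X) (hdiam : ∀ X : Finset B, ∀ e ∈ X, ∀ e' ∈ X, dist e e' ≤ ℓ X)
    -- the expansion data
    (W : Set (B → G')) (π : Λ → B) (Adm : Finset Λ → Finset B → Prop)
    (ζ : Finset Λ → Finset B → (B → G') → ℝ) (ζbar : Finset Λ → Finset B → ℝ) (sf : Λ → ℝ) (σ₀ κmu κ : ℝ)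
    (full hist : (B → G') → ℝ) (D : Finset (Finset Λ)) (g r : Finset Λ → (B → G') → ℝ)
    (hAdm : ∀ Q' X, Adm Q' X → Q'.Nonempty ∧ (∀ l ∈ Q', π l ∈ X) ∧
      ∃ F : Finset C, (H.induce (F : Set C)).Connected ∧ F.biUnion cell = X ∧ F.card = size X)
    (hℓ : ∀ X, (∃ Q', Adm Q' X) → ℓ X ≤ ℓ₀ * (size X : ℝ))
    -- (H+W) the history partition on the window, a.e.; the a.e. ratio identities on the deep histories; nothing off them
    (hsum : ∀ᵐ U ∂μ, U ∈ W → full U = ∑ Q ∈ D, g Q U)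
    (hrat : ∀ Q ∈ D, ∀ᵐ U ∂μ, U ∈ W → g Q U = hist U * r Q U)
    (hoff : ∀ Q, Q ∉ D → ∀ U, U ∈ W → r Q U = 0)
    -- the factorised expansion with holes, pointwise on the window, with continuous V-local activities
    (hr : ∀ (Q : Finset Λ) (U : B → G'), U ∈ W → r Q U =
      ∑ 𝒳 ∈ (Finset.univ : Finset (Finset B)).powerset.filter (fun 𝒳 => IsCompatible polyInc 𝒳 ∧
        (∀ l ∈ Q, ∃ X ∈ 𝒳, π l ∈ X) ∧ ∀ X ∈ 𝒳, Adm (Q.filter fun l => π l ∈ X) X),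
        ∏ X ∈ 𝒳, ζ (Q.filter fun l => π l ∈ X) X U)
    (hζc : ∀ Q' X, Adm Q' X → ContinuousOn (fun U => ζ Q' X U) W)
    (hloc : ∀ Q' X (U U' : B → G'), Adm Q' X → (∀ e ∈ X, U e = U' e) → ζ Q' X U = ζ Q' X U')
    (hdom : ∀ Q' X U, Adm Q' X → U ∈ W → |ζ Q' X U| ≤ ζbar Q' X) (hζ0 : ∀ Q' X, Adm Q' X → 0 ≤ ζbar Q' X)
    -- energy, budget, rate
    (hsf : ∀ l, 0 ≤ sf l) (hζ : ∀ Q' X, Adm Q' X → ζbar Q' X ≤ (∏ l ∈ Q', sf l) * Real.exp (-(κmu * (size X : ℝ))))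
    (hσ : ∀ X, (∃ Q', Adm Q' X) → ∑ l ∈ Finset.univ.filter (fun l => π l ∈ X), sf l ≤ σ₀ * (size X : ℝ))
    (hσ₀ : 0 ≤ σ₀) (hκ : 0 ≤ κ)
    (hμ : σ₀ * (s₀ : ℝ) + κ * ℓ₀ + (Real.log m + 2 * Real.log Δ) + σ₀ + 2 ≤ κmu) :
    ∃ (cst : ℝ) (w : (B → G') → Finset B → ℝ),
      (∃ (wbar a ℓ' : Finset B → ℝ),
        (∀ U, w U ∅ = 0) ∧
        (∀ (X : Finset B) (U U' : B → G'), (∀ e ∈ X, U e = U' e) → w U X = w U' X) ∧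
        (∀ X, 0 ≤ a X) ∧ (∀ X, 0 ≤ ℓ' X) ∧
        (∀ U, U ∈ W → ∀ X, |w U X| ≤ wbar X) ∧
        (∀ X : Finset B, ∀ e ∈ X, ∀ e' ∈ X, dist e e' ≤ ℓ' X) ∧
        (∀ X : Finset B, ∑ X' ∈ Finset.univ.filter (fun X' => polyInc X' X), wbar X' * Real.exp (a X' + κ * ℓ' X') ≤ a X) ∧
        (∀ e : B, a {e} ≤ σ₀)) ∧
      (∀ X, ContinuousOn (fun U => w U X) W) ∧
      ∀ᵐ U ∂μ, U ∈ W → full U = Real.exp cst * hist U *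
        (polymerPartitionFunction polyInc (fun X : Finset B => ((w U X : ℝ) : ℂ)) Finset.univ).re := by
  have hπ : ∀ Q' X, Adm Q' X → ∀ l ∈ Q', π l ∈ X := fun Q' X h => (hAdm Q' X h).2.1
  have hAdmE : ∀ Q', ¬ Adm Q' ∅ := by
    intro Q' h
    obtain ⟨⟨l, hl⟩, hin, -⟩ := hAdm Q' ∅ h
    exact Finset.notMem_empty _ (hin l hl)
  -- the `a`-block for the aggregated majorant (FILE 3: energy × budget × cell entropy × KPL-E)
  obtain ⟨a, ha, hKP, hpin⟩ := exists_size_of_factorised_histories H hΔ h1Δ cell hm h1m hs₀ size ℓ ℓ₀ π Adm ζbar sf σ₀ κmu κ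
    hAdm hℓ hζ0 hsf hζ hσ hσ₀ hκ hμ
  refine ⟨0, fun U X => ∑ Q' ∈ Finset.univ.filter (fun Q' : Finset Λ => Adm Q' X), ζ Q' X U,
    ⟨fun X => ∑ Q' ∈ Finset.univ.filter (fun Q' : Finset Λ => Adm Q' X), ζbar Q' X, a, ℓ,
      fun U => aggregate_empty Adm (fun Q' => ζ Q' ∅ U) hAdmE, fun X U U' hUU' => aggregate_local Adm ζ hloc X U U' hUU', ha, hℓ0,
      fun U hU X => abs_aggregate_le Adm ζ ζbar W hdom X U hU, hdiam, hKP, hpin⟩,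
    fun X => continuousOn_finsetSum _ fun Q' hQ' => hζc Q' X (Finset.mem_filter.mp hQ').2, ?_⟩
  -- the a.e. identity: (H+W) and the a.e. ratios, then the history sum is the gas of the aggregate (FILE 2)
  have hall : ∀ᵐ U ∂μ, ∀ Q ∈ D, U ∈ W → g Q U = hist U * r Q U :=
    (ae_ball_iff D.countable_toSet).mpr fun Q hQ => hrat Q hQ
  filter_upwards [hsum, hall] with U hU hUall hUW
  have h1 : ∑ Q ∈ D, g Q U = hist U * ∑ Q ∈ D, r Q U := by
    rw [Finset.mul_sum]
    exact Finset.sum_congr rfl (fun Q hQ => hUall Q hQ hUW)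
  have h2 : ∑ Q ∈ D, r Q U = ∑ Q : Finset Λ, r Q U :=
    Finset.sum_subset (Finset.subset_univ D) (fun Q _ hQ => hoff Q hQ U hUW)
  rw [hU hUW, h1, h2, Real.exp_zero, one_mul,
    sum_ratios_eq_re_gasZ π Adm (fun Q' X => ζ Q' X U) hπ (fun Q => r Q U) (fun Q => hr Q U hUW)]

/-! ## §3 The T³ letters: the ∃-body of LFG^{can}∘ at one `(J, K)` from the socket, by px10 g16's ✓`canInt_body_of_ae` -/

section T3

open Filter Topology Set
open Literature.MathematicalPhysics.QuantumFieldTheory.Balaban1983to89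
open Literature.MathematicalPhysics.QuantumFieldTheory.Balaban1983to89.T3ContinuumYM3Torus
open Literature.MathematicalPhysics.QuantumFieldTheory.Balaban1983to89.T3NestedUnitLaws
open Literature.MathematicalPhysics.QuantumFieldTheory.Balaban1983to89.T3UnitLawDensityEML
open Literature.MathematicalPhysics.QuantumFieldTheory.Balaban1983to89.T3UnitScaleTilt
open Literature.MathematicalPhysics.QuantumFieldTheory.Balaban1983to89.T3TiltDescent
open Literature.MathematicalPhysics.QuantumFieldTheory.Balaban1983to89.T3PrintedRegularMinimiser
open Literature.MathematicalPhysics.QuantumFieldTheory.Balaban1983to89.T3LevelShift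
open Literature.MathematicalPhysics.QuantumFieldTheory.Balaban1983to89.Missing
open Literature.MathematicalPhysics.QuantumFieldTheory.Balaban1983to89.T4Continuum
open scoped Literature.MathematicalPhysics.QuantumFieldTheory.Balaban1983to89.T3OrbitAverage
open Summit.QuantumFields.YangMills.Theorems.FluctuationComparisonRegPrIntLWregGlue (heightDensityCan)
open Summit.QuantumFields.YangMills.Theorems.FluctuationComparisonRegPrIntLLargeFieldGasCanonicalTransfer (canInt_body_of_ae)

open Classical in
/-- ★★★ **THE ∃-BODY OF LFG^{can}∘ AT ONE `(J, K)` FROM THE 𝐑-OPERATION'S SOCKET, IN THE T³ LETTERS** — §2 at `μ := dU_J`, `B := PBond (F.P J) 0`, `W := W_J^{c} = {PlaqSmall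
(θBal F.L γ (c·b₀) p₀ J)}`, `full ∕ hist := heightDensity … univ ∕ histGood(b₀)`, `dist := tdist`, `σ₀ := Ψ J`, composed with px10 g16's ✓`canInt_body_of_ae` under the row
(r1∘).  The conclusion is the `∃ cst w, (∃ wbar a ℓ, KPGasOn …) ∧ ∀ U ∈ W_J^{c}, heightDensityCan … univ U = e^{cst}·heightDensityCan … histGood U·Re Ξ(w U)` body of the
hypothesis of ✓`…LargeFieldGasInteriorDoor.largeFieldFourPtIntCan_of_canInt`, so the registered `stub_largeFieldFourPtIntCan` now rests on the socket letters alone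
(per deep history: the A.E. ratio identity, the continuous factorised expansion with holes, its energy bound and the K-uniform budget `Ψ J`) plus the prefix bookkeeping.
[cite: Balaban1989LargeFieldII, (1.90) p.388 and (1.97)-(1.101) pp.389-390; Balaban1985UV3, (40)-(41) p.266 and (67)-(71) pp.273-274; Balaban1987RG1, (0.13) p.254] -/
theorem canIntBody_of_factorised_histories (F : T3Family) {γ : ℝ} (b₀ p₀ c : ℝ) {J K : ℕ} (hJK : J ≤ K) {κ : ℝ} (hκ : 0 ≤ κ) (Ψ : ℕ → ℝ)
    (hR : {U : GaugeField (F.P J) 0 (Matrix.specialUnitaryGroup (Fin 2) ℂ) | PlaqSmall (θBal F.L γ (c * b₀) p₀ J) U} ⊆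
      Node00.regSet (fieldMeasure (F.P J) 0 (Matrix.specialUnitaryGroup (Fin 2) ℂ)) (heightDensity F γ hJK Set.univ))
    -- footprint geometry on the height-`J` bonds
    {C : Type*} [Fintype C] [DecidableEq C] (H : SimpleGraph C) [DecidableRel H.Adj] {Δ : ℕ} (hΔ : ∀ cc, H.degree cc ≤ Δ) (h1Δ : 1 ≤ Δ)
    (cell : C → Finset (PBond (F.P J) 0)) {m s₀ : ℕ}
    (hm : ∀ e : PBond (F.P J) 0, (Finset.univ.filter fun cc : C => e ∈ cell cc).card ≤ m) (h1m : 1 ≤ m)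
    (hs₀ : ∀ cc, (cell cc).card ≤ s₀) (size : Finset (PBond (F.P J) 0) → ℕ)
    (ℓ : Finset (PBond (F.P J) 0) → ℝ) (ℓ₀ : ℝ) (hℓ0 : ∀ X, 0 ≤ ℓ X)
    (hdiam : ∀ X : Finset (PBond (F.P J) 0), ∀ e ∈ X, ∀ e' ∈ X, (e.src.tdist e'.src : ℝ) ≤ ℓ X)
    -- the expansion data
    {Λ : Type*} [Fintype Λ] [DecidableEq Λ] (π : Λ → PBond (F.P J) 0) (Adm : Finset Λ → Finset (PBond (F.P J) 0) → Prop)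
    (ζ : Finset Λ → Finset (PBond (F.P J) 0) → GaugeField (F.P J) 0 (Matrix.specialUnitaryGroup (Fin 2) ℂ) → ℝ)
    (ζbar : Finset Λ → Finset (PBond (F.P J) 0) → ℝ) (sf : Λ → ℝ) (κmu : ℝ)
    (D : Finset (Finset Λ)) (g r : Finset Λ → GaugeField (F.P J) 0 (Matrix.specialUnitaryGroup (Fin 2) ℂ) → ℝ)
    (hAdm : ∀ Q' X, Adm Q' X → Q'.Nonempty ∧ (∀ l ∈ Q', π l ∈ X) ∧
      ∃ Fc : Finset C, (H.induce (Fc : Set C)).Connected ∧ Fc.biUnion cell = X ∧ Fc.card = size X)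
    (hℓ : ∀ X, (∃ Q', Adm Q' X) → ℓ X ≤ ℓ₀ * (size X : ℝ))
    -- the socket: (H+W) a.e., the a.e. ratio identities on the deep histories, the continuous factorised expansion, energy, budget
    (hsum : ∀ᵐ U ∂fieldMeasure (F.P J) 0 (Matrix.specialUnitaryGroup (Fin 2) ℂ), PlaqSmall (θBal F.L γ (c * b₀) p₀ J) U →
      heightDensity F γ hJK Set.univ U = ∑ Q ∈ D, g Q U)
    (hrat : ∀ Q ∈ D, ∀ᵐ U ∂fieldMeasure (F.P J) 0 (Matrix.specialUnitaryGroup (Fin 2) ℂ), PlaqSmall (θBal F.L γ (c * b₀) p₀ J) U →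
      g Q U = heightDensity F γ hJK (histGood F ℰp (θBal F.L γ b₀ p₀) K J) U * r Q U)
    (hoff : ∀ Q, Q ∉ D → ∀ U, PlaqSmall (θBal F.L γ (c * b₀) p₀ J) U → r Q U = 0)
    (hr : ∀ (Q : Finset Λ) (U : GaugeField (F.P J) 0 (Matrix.specialUnitaryGroup (Fin 2) ℂ)), PlaqSmall (θBal F.L γ (c * b₀) p₀ J) U → r Q U =
      ∑ 𝒳 ∈ (Finset.univ : Finset (Finset (PBond (F.P J) 0))).powerset.filter (fun 𝒳 => IsCompatible polyInc 𝒳 ∧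
        (∀ l ∈ Q, ∃ X ∈ 𝒳, π l ∈ X) ∧ ∀ X ∈ 𝒳, Adm (Q.filter fun l => π l ∈ X) X),
        ∏ X ∈ 𝒳, ζ (Q.filter fun l => π l ∈ X) X U)
    (hζc : ∀ Q' X, Adm Q' X → ContinuousOn (fun U => ζ Q' X U)
      {U : GaugeField (F.P J) 0 (Matrix.specialUnitaryGroup (Fin 2) ℂ) | PlaqSmall (θBal F.L γ (c * b₀) p₀ J) U})
    (hloc : ∀ Q' X (U U' : GaugeField (F.P J) 0 (Matrix.specialUnitaryGroup (Fin 2) ℂ)), Adm Q' X → (∀ e ∈ X, U e = U' e) → ζ Q' X U = ζ Q' X U')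
    (hdom : ∀ Q' X U, Adm Q' X → PlaqSmall (θBal F.L γ (c * b₀) p₀ J) U → |ζ Q' X U| ≤ ζbar Q' X)
    (hζ0 : ∀ Q' X, Adm Q' X → 0 ≤ ζbar Q' X)
    (hsf : ∀ l, 0 ≤ sf l) (hζ : ∀ Q' X, Adm Q' X → ζbar Q' X ≤ (∏ l ∈ Q', sf l) * Real.exp (-(κmu * (size X : ℝ))))
    (hσ : ∀ X, (∃ Q', Adm Q' X) → ∑ l ∈ Finset.univ.filter (fun l => π l ∈ X), sf l ≤ Ψ J * (size X : ℝ))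
    (hΨ : 0 ≤ Ψ J)
    (hμ : Ψ J * (s₀ : ℝ) + κ * ℓ₀ + (Real.log m + 2 * Real.log Δ) + Ψ J + 2 ≤ κmu) :
    ∃ (cst : ℝ) (w : GaugeField (F.P J) 0 (Matrix.specialUnitaryGroup (Fin 2) ℂ) → Finset (PBond (F.P J) 0) → ℝ),
      (∃ (wbar a ℓ' : Finset (PBond (F.P J) 0) → ℝ),
        (∀ U, w U ∅ = 0) ∧
        (∀ (X : Finset (PBond (F.P J) 0)) (U U' : GaugeField (F.P J) 0 (Matrix.specialUnitaryGroup (Fin 2) ℂ)),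
          (∀ e ∈ X, U e = U' e) → w U X = w U' X) ∧
        (∀ X, 0 ≤ a X) ∧ (∀ X, 0 ≤ ℓ' X) ∧
        (∀ U, U ∈ {U : GaugeField (F.P J) 0 (Matrix.specialUnitaryGroup (Fin 2) ℂ) | PlaqSmall (θBal F.L γ (c * b₀) p₀ J) U} →
          ∀ X, |w U X| ≤ wbar X) ∧
        (∀ X : Finset (PBond (F.P J) 0), ∀ e ∈ X, ∀ e' ∈ X, (e.src.tdist e'.src : ℝ) ≤ ℓ' X) ∧
        (∀ X : Finset (PBond (F.P J) 0), ∑ X' ∈ Finset.univ.filter (fun X' => polyInc X' X),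
            wbar X' * Real.exp (a X' + κ * ℓ' X') ≤ a X) ∧
        (∀ e : PBond (F.P J) 0, a {e} ≤ Ψ J)) ∧
      ∀ U : GaugeField (F.P J) 0 (Matrix.specialUnitaryGroup (Fin 2) ℂ), PlaqSmall (θBal F.L γ (c * b₀) p₀ J) U →
        heightDensityCan F γ hJK Set.univ U =
          Real.exp cst * heightDensityCan F γ hJK (histGood F ℰp (θBal F.L γ b₀ p₀) K J) U *
            (polymerPartitionFunction polyInc (fun X : Finset (PBond (F.P J) 0) => ((w U X : ℝ) : ℂ)) Finset.univ).re :=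
  canInt_body_of_ae F b₀ p₀ c hJK hκ Ψ hR
    (aeGas_of_factorised_histories (fieldMeasure (F.P J) 0 (Matrix.specialUnitaryGroup (Fin 2) ℂ)) H hΔ h1Δ cell hm h1m hs₀ size
      (fun e e' : PBond (F.P J) 0 => ((e.src.tdist e'.src : ℕ) : ℝ)) ℓ ℓ₀ hℓ0 hdiam
      {U : GaugeField (F.P J) 0 (Matrix.specialUnitaryGroup (Fin 2) ℂ) | PlaqSmall (θBal F.L γ (c * b₀) p₀ J) U} π Adm ζ ζbar sf (Ψ J) κmu κ
      (heightDensity F γ hJK Set.univ) (heightDensity F γ hJK (histGood F ℰp (θBal F.L γ b₀ p₀) K J)) D g r hAdm hℓ hsum hrat hoff hr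
      hζc hloc hdom hζ0 hsf hζ hσ hΨ hκ hμ)

end T3

end Summit.QuantumFields.YangMills.Theorems.FluctuationComparisonRegPrIntLLargeFieldGasKnitAE

end
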